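import Literature.MathematicalPhysics.KineticTheory.TrigPolySeries
import Literature.Analysis.Calculus.DeltaSymbolClasses
import Mathlib.Analysis.Calculus.BumpFunction.InnerProduct
import Mathlib.Analysis.Calculus.Deriv.ZPow
import Mathlib.Analysis.Calculus.IteratedDeriv.Lemmas
import HarnessLib

/-!
# `δ`-bookkeeping for symbolic trigonometric polynomials ("`g ∼ δ^{-p}`", De Roeck–Huveneers (3.12)–(3.14))

`Literature/MathematicalPhysics/KineticTheory/` — the symbol-class calculus of
`Literature/Analysis/Calculus/DeltaSymbolClasses.lean` (`IsDeltaSymbol p c`: all derivatives of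
`c δ` bounded by `C δ^{-(p+i)} (1 + ‖ω‖)^M`) applied to the coefficient families of the symbolic
trigonometric polynomials of `TrigPoly.lean`: `TrigTerm.InClass t p` / `TrigPoly.InClass F p` say that
both coefficient families of (every term of) a polynomial are `δ`-symbols of order `p`, the Lean form
of "`g ∼ δ^{-p}`" of W. De Roeck, F. Huveneers, CPAM 68 (2015), arXiv:1305.5127, §3.3.

Propagation rules (all proved): monotonicity; `smulFun` by a multiplier of class `p'` (`p' + p`);
`L_D` (`p`, the frequency `k·ω` being a linear form); `𝓡` (`p`, for a profile `ρ` with bounded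
derivatives); `L_D⁻¹(Id - 𝓡)` (`p + 1`: "`u ∼ δ^{-(n+1)}`", via the scaling
`(1 - ρ(s/δ))/s = φ(s/δ)/δ`, `φ(s) = (1 - ρ(s))/s` assumed smooth with bounded derivatives); the
bracket (`p + p' + 1`: "`L_g h ∼ δ^{-(n+m+1)}`"); and the series operations `adPow`, `expOp`,
`expOpD`, `bracketTS`, `eval`-free componentwise statements with explicit arithmetic side
conditions on the target classes. No named facts.
-/

noncomputable section

open Function Set Finset Filter
open scoped ContDiff BigOperators Topology

namespace Literature.MathematicalPhysics.KineticTheory.HeatConduction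

open Literature.Analysis.Calculus Literature.Analysis.Calculus.IsDeltaSymbol

variable {m : ℕ}

/-! ### Elementary symbols on `ℝ^m` -/

/-- Two families agreeing for `δ ∈ (0, 1]` are symbols together. [folklore] -/
theorem isDeltaSymbol_congr {E : Type*} [NormedAddCommGroup E] [NormedSpace ℝ E] {p : ℕ} {c c' : ℝ → E → ℝ}
    (h : IsDeltaSymbol p c) (hc : ∀ δ, 0 < δ → δ ≤ 1 → c' δ = c δ) : IsDeltaSymbol p c' := by
  refine ⟨fun δ hδ hδ1 => by rw [hc δ hδ hδ1]; exact h.contDiff hδ hδ1, fun i => ?_⟩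
  obtain ⟨C, M, hC, hb⟩ := h.bound i
  exact ⟨C, M, hC, fun δ hδ hδ1 x => by rw [hc δ hδ hδ1]; exact hb δ hδ hδ1 x⟩

/-- Division by `2` keeps the class. [folklore] -/
theorem isDeltaSymbol_div_two {E : Type*} [NormedAddCommGroup E] [NormedSpace ℝ E] {p : ℕ} {c : ℝ → E → ℝ}
    (h : IsDeltaSymbol p c) : IsDeltaSymbol p (fun δ x => c δ x / 2) := by
  have := h.const_mul (1 / 2)
  refine isDeltaSymbol_congr this fun δ _ _ => ?_
  funext x; ring

/-- A smooth global model of `t ↦ 1/t` on `[1/2, ∞)`: `(1 - β(4t))/t` for a bump `β` (`= 1` on `[-1,1]`,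
`= 0` outside `(-2,2)`). [folklore] -/
def invModel (t : ℝ) : ℝ :=
  TrigTerm.cutDiv (fun s => ((⟨1, 2, one_pos, one_lt_two⟩ : ContDiffBump (0 : ℝ)) : ℝ → ℝ) s) (1 / 4) t

/-- The model is smooth. [folklore] -/
theorem contDiff_invModel : ContDiff ℝ ∞ invModel := by
  unfold invModel
  refine TrigTerm.contDiff_cutDiv (ContDiffBump.contDiff _) ?_ _
  exact (⟨1, 2, one_pos, one_lt_two⟩ : ContDiffBump (0 : ℝ)).eventuallyEq_one

/-- The model is `1/t` near every `t > 1/2`. [folklore] -/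
theorem invModel_eventuallyEq {t : ℝ} (ht : 1 / 2 < t) : invModel =ᶠ[𝓝 t] (Inv.inv : ℝ → ℝ) := by
  have hopen : IsOpen {s : ℝ | 1 / 2 < s} := isOpen_lt continuous_const continuous_id
  filter_upwards [hopen.mem_nhds ht] with s hs
  have hs' : 1 / 2 < s := hs
  have hz : ((⟨1, 2, one_pos, one_lt_two⟩ : ContDiffBump (0 : ℝ)) : ℝ → ℝ) (s / (1 / 4)) = 0 := by
    apply ContDiffBump.zero_of_le_dist
    simp only [Real.dist_eq, sub_zero]
    rw [abs_of_pos (by positivity)]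
    linarith
  show (1 - ((⟨1, 2, one_pos, one_lt_two⟩ : ContDiffBump (0 : ℝ)) : ℝ → ℝ) (s / (1 / 4))) / s = s⁻¹
  rw [hz, sub_zero, _root_.one_div]

/-- Derivatives of the model at `t ≥ 1` are bounded by `i!`. [folklore] -/
theorem norm_iteratedFDeriv_invModel_le {t : ℝ} (ht : 1 ≤ t) (i : ℕ) : ‖iteratedFDeriv ℝ i invModel t‖ ≤ i.factorial := by
  rw [norm_iteratedFDeriv_eq_norm_iteratedDeriv, (invModel_eventuallyEq (by linarith)).iteratedDeriv_eq i,
    iteratedDeriv_eq_iterate, iter_deriv_inv]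
  rw [norm_mul, norm_mul, norm_pow, norm_neg, norm_one, one_pow, one_mul, Real.norm_natCast]
  refine mul_le_of_le_one_right (Nat.cast_nonneg _) ?_
  rw [show (-1 - i : ℤ) = -((i + 1 : ℕ) : ℤ) by push_cast; ring, zpow_neg, zpow_natCast, norm_inv, norm_pow,
    Real.norm_eq_abs, abs_of_pos (by linarith)]
  exact inv_le_one_of_one_le₀ (one_le_pow₀ ht)

/-- **Inverses of symbols bounded below by `1` are symbols of order `0`** (Faà di Bruno bound
`norm_iteratedFDeriv_comp_le` with the model of `1/t`). [folklore] -/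
theorem isDeltaSymbol_inv {E : Type*} [NormedAddCommGroup E] [NormedSpace ℝ E] {c : ℝ → E → ℝ}
    (h : IsDeltaSymbol 0 c) (h1 : ∀ δ, 0 < δ → δ ≤ 1 → ∀ x, 1 ≤ c δ x) :
    IsDeltaSymbol 0 (fun δ x => (c δ x)⁻¹) := by
  have hcomp : ∀ δ, 0 < δ → δ ≤ 1 → (fun x => (c δ x)⁻¹) = invModel ∘ c δ := by
    intro δ hδ hδ1; funext x
    have := (invModel_eventuallyEq (t := c δ x) (by linarith [h1 δ hδ hδ1 x])).eq_of_nhds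
    simpa using this.symm
  refine ⟨fun δ hδ hδ1 => ?_, fun i => ?_⟩
  · show ContDiff ℝ ∞ (fun x => (c δ x)⁻¹)
    rw [hcomp δ hδ hδ1]; exact contDiff_invModel.comp (h.contDiff hδ hδ1)
  -- a geometric bound `‖D^j (c δ) x‖ ≤ (K (1+‖x‖)^M / δ)^j` for `1 ≤ j ≤ i`
  choose C M hC hb using h.bound
  set K : ℝ := ∑ j ∈ Finset.range (i + 1), (C j + 1) with hK
  set Mt : ℕ := ∑ j ∈ Finset.range (i + 1), M j with hMt
  have hK1 : 1 ≤ K := by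
    rw [hK, Finset.sum_range_succ']
    have : 0 ≤ ∑ j ∈ Finset.range i, (C (j + 1) + 1) := Finset.sum_nonneg fun j _ => by linarith [hC (j + 1)]
    linarith [hC 0]
  refine ⟨i.factorial * i.factorial * K ^ i, Mt * i, by positivity, fun δ hδ hδ1 x => ?_⟩
  have hw1 := one_le_weight x
  set D : ℝ := K * (1 + ‖x‖) ^ Mt / δ with hD
  have hD0 : 0 ≤ D := by positivity
  have hDj : ∀ j, 1 ≤ j → j ≤ i → ‖iteratedFDeriv ℝ j (c δ) x‖ ≤ D ^ j := by
    intro j hj1 hji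
    have hb' := hb j δ hδ hδ1 x
    rw [zero_add] at hb'
    refine hb'.trans ?_
    have hCK : C j ≤ K := by
      rw [hK]
      have : C j + 1 ≤ ∑ j ∈ Finset.range (i + 1), (C j + 1) :=
        Finset.single_le_sum (f := fun j => C j + 1) (fun j _ => by linarith [hC j]) (Finset.mem_range.2 (by omega))
      linarith
    have hMM : M j ≤ Mt := by
      rw [hMt]; exact Finset.single_le_sum (f := M) (fun _ _ => Nat.zero_le _) (Finset.mem_range.2 (by omega))
    calc C j / δ ^ j * (1 + ‖x‖) ^ M j ≤ K / δ ^ j * (1 + ‖x‖) ^ Mt := by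
          gcongr
        _ ≤ K ^ j / δ ^ j * ((1 + ‖x‖) ^ Mt) ^ j := by
          gcongr
          · exact le_self_pow₀ hK1 (by omega)
          · exact le_self_pow₀ (one_le_pow₀ hw1) (by omega)
        _ = D ^ j := by rw [hD, _root_.div_pow, mul_pow]; ring
  have hle := norm_iteratedFDeriv_comp_le (g := invModel) (f := c δ) (n := i) (N := ∞) contDiff_invModel
    (h.contDiff hδ hδ1) (natCast_le_infty i) x (C := i.factorial)
    (fun j hj => (norm_iteratedFDeriv_invModel_le (h1 δ hδ hδ1 x) j).trans (by exact_mod_cast Nat.factorial_le hj)) hDj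
  show ‖iteratedFDeriv ℝ i (fun x => (c δ x)⁻¹) x‖ ≤ _
  rw [hcomp δ hδ hδ1]
  refine hle.trans (le_of_eq ?_)
  rw [hD, _root_.div_pow, mul_pow, ← pow_mul, zero_add]
  ring

/-- The frequency `ω ↦ k·ω` as a continuous linear form. [folklore] -/
def modeFreqCLM (k : Fin m → ℤ) : (Fin m → ℝ) →L[ℝ] ℝ :=
  ∑ x : Fin m, (k x : ℝ) • ContinuousLinearMap.proj x

/-- `modeFreqCLM k ω = k·ω`. [folklore] -/
@[simp] theorem modeFreqCLM_apply (k : Fin m → ℤ) (w : Fin m → ℝ) : modeFreqCLM k w = modeFreq k w := by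
  simp [modeFreqCLM, modeFreq, modePhase]

/-- The frequency family `(δ, ω) ↦ k·ω` is a symbol of order `0`. [folklore] -/
theorem isDeltaSymbol_modeFreq (k : Fin m → ℤ) : IsDeltaSymbol 0 (fun (_ : ℝ) (w : Fin m → ℝ) => modeFreq k w) := by
  have h := IsDeltaSymbol.clm (modeFreqCLM k)
  refine isDeltaSymbol_congr h fun δ _ _ => ?_
  funext w; simp

/-- A coordinate family `(δ, ω) ↦ ω_y` is a symbol of order `0`. [folklore] -/
theorem isDeltaSymbol_coord (y : Fin m) : IsDeltaSymbol 0 (fun (_ : ℝ) (w : Fin m → ℝ) => w y) := by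
  have h := IsDeltaSymbol.clm (ContinuousLinearMap.proj (R := ℝ) (φ := fun _ : Fin m => ℝ) y)
  refine isDeltaSymbol_congr h fun δ _ _ => ?_
  funext w; rfl

/-- **The cut-off multiplier `ρ(k·ω/δ)` is of order `0`** for a profile with bounded derivatives.
[cite: DeRoeckHuveneers2015, §3.3 (3.13)] -/
theorem isDeltaSymbol_cutoff_modeFreq {ρ : ℝ → ℝ} (hρ : ContDiff ℝ ∞ ρ)
    (hb : ∀ i : ℕ, ∃ B : ℝ, 0 ≤ B ∧ ∀ s : ℝ, ‖iteratedFDeriv ℝ i ρ s‖ ≤ B) (k : Fin m → ℤ) :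
    IsDeltaSymbol 0 (fun δ (w : Fin m → ℝ) => ρ (modeFreq k w / δ)) := by
  have h := IsDeltaSymbol.comp_clm_div hρ hb (modeFreqCLM k)
  refine isDeltaSymbol_congr h fun δ _ _ => ?_
  funext w; simp

/-- **The divided cut-off multiplier `(1 - ρ(k·ω/δ))/(k·ω)` is of order `1`** ("`u ∼ δ^{-(n+1)}`"), for a
profile `ρ` whose divided profile `φ(s) = (1 - ρ(s))/s` is smooth with bounded derivatives.
[cite: DeRoeckHuveneers2015, §3.3 proof of (3.14)] -/
theorem isDeltaSymbol_cutDiv_modeFreq {ρ : ℝ → ℝ} (hφ : ContDiff ℝ ∞ (TrigTerm.cutDiv ρ 1))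
    (hb : ∀ i : ℕ, ∃ B : ℝ, 0 ≤ B ∧ ∀ s : ℝ, ‖iteratedFDeriv ℝ i (TrigTerm.cutDiv ρ 1) s‖ ≤ B) (k : Fin m → ℤ) :
    IsDeltaSymbol 1 (fun δ (w : Fin m → ℝ) => TrigTerm.cutDiv ρ δ (modeFreq k w)) := by
  have h := (IsDeltaSymbol.comp_clm_div hφ hb (modeFreqCLM k)).div_pow 1
  refine isDeltaSymbol_congr h fun δ hδ _ => ?_
  funext w
  simp only [modeFreqCLM_apply, pow_one]
  -- `(1 - ρ(s/δ))/s = ((1 - ρ(s/δ))/(s/δ))/δ`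
  unfold TrigTerm.cutDiv
  rw [div_one]
  rcases eq_or_ne (modeFreq k w) 0 with hs | hs
  · simp [hs]
  · field_simp

namespace TrigTerm

/-! ### Classes of terms -/

/-- A term is "`∼ δ^{-p}`": both coefficient families are `δ`-symbols of order `p`.
[cite: DeRoeckHuveneers2015, §3.3 ("`g ∼ δ^{-n}`")] -/
def InClass (t : TrigTerm m) (p : ℕ) : Prop := IsDeltaSymbol p t.cosCoeff ∧ IsDeltaSymbol p t.sinCoeff

variable {p p' : ℕ}

/-- Monotonicity. [folklore] -/
theorem InClass.mono {t : TrigTerm m} (h : t.InClass p) {q : ℕ} (hpq : p ≤ q) : t.InClass q :=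
  ⟨h.1.mono hpq, h.2.mono hpq⟩

/-- Members of a class are smooth at every scale `δ ∈ (0, 1]`. [folklore] -/
theorem InClass.smoothAt {t : TrigTerm m} (h : t.InClass p) {δ : ℝ} (hδ : 0 < δ) (hδ1 : δ ≤ 1) : t.SmoothAt δ :=
  ⟨h.1.contDiff hδ hδ1, h.2.contDiff hδ hδ1⟩

/-- Functional multiples: multiplier of order `p'`, term of order `p` ⇒ order `p' + p`. [cite: DeRoeckHuveneers2015, §3.3] -/
theorem InClass.smulFun {t : TrigTerm m} (h : t.InClass p) {θ : ℝ → (Fin m → ℝ) → ℝ} (hθ : IsDeltaSymbol p' θ) :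
    (t.smulFun θ).InClass (p' + p) :=
  ⟨hθ.mul h.1, hθ.mul h.2⟩

/-- Negation keeps the class. [folklore] -/
theorem InClass.neg {t : TrigTerm m} (h : t.InClass p) : t.neg.InClass p := ⟨h.1.neg, h.2.neg⟩

/-- `L_D` keeps the class (the frequency is a linear form). [cite: DeRoeckHuveneers2015, §3.3] -/
theorem InClass.bracketD {t : TrigTerm m} (h : t.InClass p) : t.bracketD.InClass p := by
  have h0 := isDeltaSymbol_modeFreq t.mode
  have ha := h0.mul h.2
  have hb := (h0.mul h.1).neg
  rw [Nat.zero_add] at ha hb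
  exact ⟨ha, hb⟩

/-- `𝓡` keeps the class (profile with bounded derivatives). [cite: DeRoeckHuveneers2015, §3.3 (3.13)] -/
theorem InClass.resCut {t : TrigTerm m} (h : t.InClass p) {ρ : ℝ → ℝ} (hρ : ContDiff ℝ ∞ ρ)
    (hb : ∀ i : ℕ, ∃ B : ℝ, 0 ≤ B ∧ ∀ s : ℝ, ‖iteratedFDeriv ℝ i ρ s‖ ≤ B) : (t.resCut ρ).InClass p := by
  have := h.smulFun (isDeltaSymbol_cutoff_modeFreq hρ hb t.mode)
  rw [Nat.zero_add] at this
  exact this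

/-- **`L_D⁻¹(Id - 𝓡)` raises the class by one.** [cite: DeRoeckHuveneers2015, §3.3 proof of (3.14) ("`u ∼ δ^{-(n+1)}`")] -/
theorem InClass.solve {t : TrigTerm m} (h : t.InClass p) {ρ : ℝ → ℝ} (hφ : ContDiff ℝ ∞ (cutDiv ρ 1))
    (hb : ∀ i : ℕ, ∃ B : ℝ, 0 ≤ B ∧ ∀ s : ℝ, ‖iteratedFDeriv ℝ i (cutDiv ρ 1) s‖ ≤ B) :
    (t.solve ρ).InClass (p + 1) := by
  have h1 := isDeltaSymbol_cutDiv_modeFreq hφ hb t.mode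
  have ha := (h1.mul h.2).neg
  have hb' := h1.mul h.1
  rw [Nat.add_comm 1 p] at ha hb'
  exact ⟨ha, hb'⟩

/-- Directional derivatives of a coefficient family raise the class by one. [cite: DeRoeckHuveneers2015, §3.3] -/
theorem isDeltaSymbol_dirDeriv {c : ℝ → (Fin m → ℝ) → ℝ} (hc : IsDeltaSymbol p c) (k : Fin m → ℤ) :
    IsDeltaSymbol (p + 1) (dirDeriv k c) :=
  hc.fderiv_apply (modeVec k)

/-- **The bracket of terms of orders `p`, `p'` has order `p + p' + 1`** ("`L_g h ∼ δ^{-(n+m+1)}`").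
[cite: DeRoeckHuveneers2015, §3.3 proof of (3.14)] -/
theorem InClass.bracket {t t' : TrigTerm m} (h : t.InClass p) (h' : t'.InClass p') {s : TrigTerm m}
    (hs : s ∈ t.bracket t') : s.InClass (p + p' + 1) := by
  have hA : IsDeltaSymbol (p + p' + 1) fun δ w => dirDeriv t'.mode t.cosCoeff δ w * t'.sinCoeff δ w :=
    ((isDeltaSymbol_dirDeriv h.1 t'.mode).mul h'.2).mono (by omega)
  have hA' : IsDeltaSymbol (p + p' + 1) fun δ w => dirDeriv t'.mode t.cosCoeff δ w * t'.cosCoeff δ w :=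
    ((isDeltaSymbol_dirDeriv h.1 t'.mode).mul h'.1).mono (by omega)
  have hB : IsDeltaSymbol (p + p' + 1) fun δ w => dirDeriv t'.mode t.sinCoeff δ w * t'.cosCoeff δ w :=
    ((isDeltaSymbol_dirDeriv h.2 t'.mode).mul h'.1).mono (by omega)
  have hB' : IsDeltaSymbol (p + p' + 1) fun δ w => dirDeriv t'.mode t.sinCoeff δ w * t'.sinCoeff δ w :=
    ((isDeltaSymbol_dirDeriv h.2 t'.mode).mul h'.2).mono (by omega)
  have hC : IsDeltaSymbol (p + p' + 1) fun δ w => t.cosCoeff δ w * dirDeriv t.mode t'.sinCoeff δ w :=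
    (h.1.mul (isDeltaSymbol_dirDeriv h'.2 t.mode)).mono (by omega)
  have hC' : IsDeltaSymbol (p + p' + 1) fun δ w => t.cosCoeff δ w * dirDeriv t.mode t'.cosCoeff δ w :=
    (h.1.mul (isDeltaSymbol_dirDeriv h'.1 t.mode)).mono (by omega)
  have hD : IsDeltaSymbol (p + p' + 1) fun δ w => t.sinCoeff δ w * dirDeriv t.mode t'.cosCoeff δ w :=
    (h.2.mul (isDeltaSymbol_dirDeriv h'.1 t.mode)).mono (by omega)
  have hD' : IsDeltaSymbol (p + p' + 1) fun δ w => t.sinCoeff δ w * dirDeriv t.mode t'.sinCoeff δ w :=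
    (h.2.mul (isDeltaSymbol_dirDeriv h'.2 t.mode)).mono (by omega)
  simp only [TrigTerm.bracket, List.mem_cons, List.mem_nil_iff, or_false] at hs
  rcases hs with rfl | rfl
  · exact ⟨isDeltaSymbol_div_two (((hA.add hB).sub hC).sub hD), isDeltaSymbol_div_two (((hA'.neg.add hB').add hC').sub hD')⟩
  · exact ⟨isDeltaSymbol_div_two (((hA.sub hB).add hC).sub hD), isDeltaSymbol_div_two (((hA'.add hB').add hC').add hD')⟩

end TrigTerm

namespace TrigPoly

/-! ### Classes of polynomials -/

/-- Every term is "`∼ δ^{-p}`". [cite: DeRoeckHuveneers2015, §3.3] -/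
def InClass (F : TrigPoly m) (p : ℕ) : Prop := ∀ t ∈ F, t.InClass p

variable {F G : TrigPoly m} {p p' : ℕ}

/-- Monotonicity. [folklore] -/
theorem InClass.mono (h : F.InClass p) {q : ℕ} (hpq : p ≤ q) : F.InClass q := fun t ht => (h t ht).mono hpq

/-- The empty polynomial is in every class. [folklore] -/
theorem inClass_nil (p : ℕ) : InClass ([] : TrigPoly m) p := fun _ h => by simp at h

/-- Concatenation. [folklore] -/
theorem InClass.append (hF : F.InClass p) (hG : G.InClass p) : InClass (F ++ G) p :=
  fun t ht => by rcases List.mem_append.1 ht with h | h; exacts [hF t h, hG t h]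

/-- Flat-maps. [folklore] -/
theorem inClass_flatMap {α : Type*} {l : List α} {f : α → TrigPoly m} (h : ∀ a ∈ l, (f a).InClass p) :
    InClass (l.flatMap f) p := fun t ht => by
  obtain ⟨a, ha, hta⟩ := List.mem_flatMap.1 ht
  exact h a ha t hta

/-- Members of a class are smooth at every scale `δ ∈ (0, 1]`. [folklore] -/
theorem InClass.smoothAt (h : F.InClass p) {δ : ℝ} (hδ : 0 < δ) (hδ1 : δ ≤ 1) : F.SmoothAt δ :=
  fun t ht => (h t ht).smoothAt hδ hδ1

/-- Functional multiples. [cite: DeRoeckHuveneers2015, §3.3] -/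
theorem InClass.smulFun (h : F.InClass p) {θ : ℝ → (Fin m → ℝ) → ℝ} (hθ : IsDeltaSymbol p' θ) :
    InClass (TrigPoly.smulFun θ F) (p' + p) := fun s hs => by
  obtain ⟨t, ht, rfl⟩ := List.mem_map.1 hs
  exact (h t ht).smulFun hθ

/-- Real multiples. [folklore] -/
theorem InClass.constSMul (h : F.InClass p) (c : ℝ) : InClass (TrigPoly.constSMul c F) p := by
  have := h.smulFun (IsDeltaSymbol.const (E := Fin m → ℝ) c)
  simpa [TrigPoly.constSMul] using this

/-- Negation. [folklore] -/
theorem InClass.neg (h : F.InClass p) : InClass (TrigPoly.neg F) p := fun s hs => by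
  obtain ⟨t, ht, rfl⟩ := List.mem_map.1 hs
  exact (h t ht).neg

/-- `L_D`. [cite: DeRoeckHuveneers2015, §3.3] -/
theorem InClass.bracketD (h : F.InClass p) : InClass (TrigPoly.bracketD F) p := fun s hs => by
  obtain ⟨t, ht, rfl⟩ := List.mem_map.1 hs
  exact (h t ht).bracketD

/-- `𝓡`. [cite: DeRoeckHuveneers2015, §3.3 (3.13)] -/
theorem InClass.resCut (h : F.InClass p) {ρ : ℝ → ℝ} (hρ : ContDiff ℝ ∞ ρ)
    (hb : ∀ i : ℕ, ∃ B : ℝ, 0 ≤ B ∧ ∀ s : ℝ, ‖iteratedFDeriv ℝ i ρ s‖ ≤ B) : InClass (TrigPoly.resCut ρ F) p :=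
  fun s hs => by
    obtain ⟨t, ht, rfl⟩ := List.mem_map.1 hs
    exact (h t ht).resCut hρ hb

/-- `L_D⁻¹(Id - 𝓡)` raises the class by one. [cite: DeRoeckHuveneers2015, §3.3 proof of (3.14)] -/
theorem InClass.solve (h : F.InClass p) {ρ : ℝ → ℝ} (hφ : ContDiff ℝ ∞ (TrigTerm.cutDiv ρ 1))
    (hb : ∀ i : ℕ, ∃ B : ℝ, 0 ≤ B ∧ ∀ s : ℝ, ‖iteratedFDeriv ℝ i (TrigTerm.cutDiv ρ 1) s‖ ≤ B) :
    InClass (TrigPoly.solve ρ F) (p + 1) := fun s hs => by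
  obtain ⟨t, ht, rfl⟩ := List.mem_map.1 hs
  exact (h t ht).solve hφ hb

/-- **The bracket**: orders `p`, `p'` ⇒ order `p + p' + 1`. [cite: DeRoeckHuveneers2015, §3.3 proof of (3.14)] -/
theorem InClass.bracket (hF : F.InClass p) (hG : G.InClass p') (r r' : ℕ) :
    InClass (TrigPoly.bracket r r' F G) (p + p' + 1) := by
  refine inClass_flatMap fun t ht => inClass_flatMap fun t' ht' => ?_
  by_cases hd : Nat.dist t.pos.val t'.pos.val ≤ r + r'
  · rw [if_pos hd]; exact fun s hs => (hF t ht).bracket (hG t' ht') hs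
  · rw [if_neg hd]; exact inClass_nil _

end TrigPoly

namespace SymSeries

/-! ### Classes through the series operations -/

variable {n : ℕ}

/-- Iterated brackets: `F ∼ δ^{-c}`, `U ∼ δ^{-cU}` ⇒ `ad_U^i F ∼ δ^{-(c + i(cU+1))}`. [cite: DeRoeckHuveneers2015, §3.3 proof of (3.14)] -/
theorem inClass_adPow {rU : ℕ} {U : TrigPoly m} {cU : ℕ} (hU : U.InClass cU) :
    ∀ (i : ℕ) {r : ℕ} {F : TrigPoly m} {c : ℕ}, F.InClass c → (adPow rU U i r F).InClass (c + i * (cU + 1)) := by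
  intro i
  induction i with
  | zero => intro r F c hF; simpa [adPow] using hF
  | succ i ih =>
    intro r F c hF
    simp only [adPow]
    refine (hU.bracket (ih hF) _ _).mono ?_
    ring_nf; omega

/-- **Classes through `e^{ε^p ad U}`** (generic form): with `U ∼ δ^{-cU}`, `S_j ∼ δ^{-cS j}` (`j ≤ n`),
every component `j ≤ n` of `expOp` is of any order `c j` dominating all contributions
`cS (j - ip) + i (cU + 1)`, `i p ≤ j`, `1 ≤ i ≤ n`, and `cS j`. [cite: DeRoeckHuveneers2015, §3.3 proof of (3.14)] -/
theorem inClass_expOp {p rU : ℕ} {U : TrigPoly m} {cU : ℕ} (hU : U.InClass cU) {rS : ℕ} {S : SymSeries m}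
    {cS c : ℕ → ℕ} (hS : ∀ j ≤ n, (S j).InClass (cS j)) (h0 : ∀ j ≤ n, cS j ≤ c j)
    (hi : ∀ j i, j ≤ n → 1 ≤ i → i ≤ n → i * p ≤ j → cS (j - i * p) + i * (cU + 1) ≤ c j) :
    ∀ j ≤ n, (expOp n p rU U rS S j).InClass (c j) := by
  intro j hj
  refine TrigPoly.inClass_flatMap fun i hi' => ?_
  have hin : i ≤ n := Nat.lt_succ_iff.1 (List.mem_range.1 hi')
  by_cases h : i * p ≤ j
  · rw [if_pos h]
    by_cases hi0 : i = 0
    · rw [if_pos hi0]; exact (hS j hj).mono (h0 j hj)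
    · rw [if_neg hi0]
      exact ((inClass_adPow hU i (hS (j - i * p) (le_trans (Nat.sub_le _ _) hj))).constSMul _).mono
        (hi j i hj (Nat.pos_of_ne_zero hi0) hin h)
  · rw [if_neg h]; exact TrigPoly.inClass_nil _

/-- **Classes through the sharp `e^{ε^p ad U}`**: as `inClass_expOp`, with the contributions hitting
the order-`0` component replaced by `cD + (i - 1)(cU + 1)` (`UD ∼ δ^{-cD}`, `i p = j`).
[cite: DeRoeckHuveneers2015, §3.3 proof of (3.14) ("`S^{(k)} D ∼ δ^{-2k}`")] -/
theorem inClass_expOpD {p rU : ℕ} {U UD : TrigPoly m} {cU cD : ℕ} (hU : U.InClass cU) (hUD : UD.InClass cD)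
    {rS : ℕ} {S : SymSeries m} {cS c : ℕ → ℕ} (hS : ∀ j ≤ n, (S j).InClass (cS j)) (h0 : ∀ j ≤ n, cS j ≤ c j)
    (hi : ∀ j i, j ≤ n → 1 ≤ i → i ≤ n → i * p < j → cS (j - i * p) + i * (cU + 1) ≤ c j)
    (hiD : ∀ j i, j ≤ n → 1 ≤ i → i ≤ n → i * p = j → cD + (i - 1) * (cU + 1) ≤ c j) :
    ∀ j ≤ n, (expOpD n p rU U UD rS S j).InClass (c j) := by
  intro j hj
  refine TrigPoly.inClass_flatMap fun i hi' => ?_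
  have hin : i ≤ n := Nat.lt_succ_iff.1 (List.mem_range.1 hi')
  by_cases h : i * p ≤ j
  · rw [if_pos h]
    by_cases hi0 : i = 0
    · rw [if_pos hi0]; exact (hS j hj).mono (h0 j hj)
    · rw [if_neg hi0]
      by_cases hij : i * p = j
      · rw [if_pos hij]
        exact ((inClass_adPow hU (i - 1) hUD).constSMul _).mono (hiD j i hj (Nat.pos_of_ne_zero hi0) hin hij)
      · rw [if_neg hij]
        exact ((inClass_adPow hU i (hS (j - i * p) (le_trans (Nat.sub_le _ _) hj))).constSMul _).mono
          (hi j i hj (Nat.pos_of_ne_zero hi0) hin (lt_of_le_of_ne h hij))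
  · rw [if_neg h]; exact TrigPoly.inClass_nil _

/-- Classes after replacing a component. [folklore] -/
theorem inClass_update {S : SymSeries m} {c : ℕ → ℕ} (hS : ∀ j ≤ n, (S j).InClass (c j)) (k : ℕ) {P : TrigPoly m}
    (hP : P.InClass (c k)) : ∀ j ≤ n, (Function.update S k P j).InClass (c j) := by
  intro j hj
  by_cases hjk : j = k
  · subst hjk; rw [Function.update_self]; exact hP
  · rw [Function.update_of_ne hjk]; exact hS j hj

/-- **Classes through the truncated bracket**: component `j` of `S * S'` is of any order dominating
`cS i + cS' (j - i) + 1`, `i ≤ j`. [cite: DeRoeckHuveneers2015, §3.3] -/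
theorem inClass_bracketTS {r r' : ℕ} {S S' : SymSeries m} {cS cS' c : ℕ → ℕ} (hS : ∀ j ≤ n, (S j).InClass (cS j))
    (hS' : ∀ j ≤ n, (S' j).InClass (cS' j)) (hc : ∀ j i, j ≤ n → i ≤ j → cS i + cS' (j - i) + 1 ≤ c j) :
    ∀ j ≤ n, (bracketTS r r' S S' j).InClass (c j) := by
  intro j hj
  refine TrigPoly.inClass_flatMap fun i hi' => ?_
  have hij : i ≤ j := Nat.lt_succ_iff.1 (List.mem_range.1 hi')
  exact ((hS i (hij.trans hj)).bracket (hS' (j - i) (le_trans (Nat.sub_le _ _) hj)) r r').mono (hc j i hj hij)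

end SymSeries

/-! ### Mode bookkeeping: `|k|_∞ ≤ B` (the set `K_r` of §4.1) -/

namespace TrigPoly

/-- All modes have sup-norm `≤ B`. [cite: DeRoeckHuveneers2015, §4.1 ("`max_x |k_x| ≤ r`")] -/
def ModeBound (F : TrigPoly m) (B : ℕ) : Prop := ∀ t ∈ F, ∀ y : Fin m, |t.mode y| ≤ B

variable {F G : TrigPoly m} {B B' : ℕ}

/-- Monotonicity. [folklore] -/
theorem ModeBound.mono (h : F.ModeBound B) (hBB' : B ≤ B') : F.ModeBound B' :=
  fun t ht y => (h t ht y).trans (by exact_mod_cast hBB')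

/-- The empty polynomial. [folklore] -/
theorem modeBound_nil (B : ℕ) : ModeBound ([] : TrigPoly m) B := fun _ h => by simp at h

/-- Concatenation. [folklore] -/
theorem ModeBound.append (hF : F.ModeBound B) (hG : G.ModeBound B) : ModeBound (F ++ G) B :=
  fun t ht => by rcases List.mem_append.1 ht with h | h; exacts [hF t h, hG t h]

/-- Flat-maps. [folklore] -/
theorem modeBound_flatMap {α : Type*} {l : List α} {f : α → TrigPoly m} (h : ∀ a ∈ l, (f a).ModeBound B) :
    ModeBound (l.flatMap f) B := fun t ht => by
  obtain ⟨a, ha, hta⟩ := List.mem_flatMap.1 ht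
  exact h a ha t hta

/-- Termwise operations keeping the mode keep the bound. [folklore] -/
theorem ModeBound.map {g : TrigTerm m → TrigTerm m} (hg : ∀ t, (g t).mode = t.mode) (h : F.ModeBound B) :
    ModeBound (F.map g) B := fun s hs y => by
  obtain ⟨t, ht, rfl⟩ := List.mem_map.1 hs
  rw [hg]; exact h t ht y

/-- `smulFun` keeps the bound. [folklore] -/
theorem ModeBound.smulFun (h : F.ModeBound B) (θ : ℝ → (Fin m → ℝ) → ℝ) : ModeBound (TrigPoly.smulFun θ F) B :=
  h.map fun _ => rfl

/-- `constSMul` keeps the bound. [folklore] -/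
theorem ModeBound.constSMul (h : F.ModeBound B) (c : ℝ) : ModeBound (TrigPoly.constSMul c F) B := h.map fun _ => rfl

/-- `neg` keeps the bound. [folklore] -/
theorem ModeBound.neg (h : F.ModeBound B) : ModeBound (TrigPoly.neg F) B := h.map fun _ => rfl

/-- `L_D` keeps the bound. [folklore] -/
theorem ModeBound.bracketD (h : F.ModeBound B) : ModeBound (TrigPoly.bracketD F) B := h.map fun _ => rfl

/-- `𝓡` keeps the bound. [folklore] -/
theorem ModeBound.resCut (h : F.ModeBound B) (ρ : ℝ → ℝ) : ModeBound (TrigPoly.resCut ρ F) B := h.map fun _ => rfl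

/-- `L_D⁻¹(Id - 𝓡)` keeps the bound. [folklore] -/
theorem ModeBound.solve (h : F.ModeBound B) (ρ : ℝ → ℝ) : ModeBound (TrigPoly.solve ρ F) B := h.map fun _ => rfl

/-- The bracket adds the bounds (modes `k ± k'`). [cite: DeRoeckHuveneers2015, §3.3] -/
theorem ModeBound.bracket (hF : F.ModeBound B) (hG : G.ModeBound B') (r r' : ℕ) :
    ModeBound (TrigPoly.bracket r r' F G) (B + B') := by
  intro s hs y
  obtain ⟨t, ht, t', ht', -, -, hmode⟩ := pos_mem_bracket hs
  have h1 := hF t ht y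
  have h2 := hG t' ht' y
  rcases hmode with h | h <;> rw [h]
  · simp only [Pi.add_apply]; push_cast; exact (abs_add_le _ _).trans (add_le_add h1 h2)
  · simp only [Pi.sub_apply]; push_cast; exact (abs_sub _ _).trans (add_le_add h1 h2)

end TrigPoly

namespace SymSeries

variable {n : ℕ}

/-- Iterated brackets: bound `B + i B_U`. [folklore] -/
theorem modeBound_adPow {rU : ℕ} {U : TrigPoly m} {BU : ℕ} (hU : U.ModeBound BU) :
    ∀ (i : ℕ) {r : ℕ} {F : TrigPoly m} {B : ℕ}, F.ModeBound B → (adPow rU U i r F).ModeBound (B + i * BU) := by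
  intro i
  induction i with
  | zero => intro r F B hF; simpa [adPow] using hF
  | succ i ih =>
    intro r F B hF
    simp only [adPow]
    refine (hU.bracket (ih hF) _ _).mono ?_
    ring_nf; omega

/-- `e^{ε^p ad U}` (both forms): all components bounded by `B + n B_U` when all inputs are bounded by
`B` and `U`, `UD` by `B_U ≤ B`. [folklore] -/
theorem modeBound_expOpD {p rU : ℕ} {U UD : TrigPoly m} {BU : ℕ} (hU : U.ModeBound BU) (hUD : UD.ModeBound BU)
    {rS : ℕ} {S : SymSeries m} {B : ℕ} (hS : ∀ j ≤ n, (S j).ModeBound B) (hB : BU ≤ B) :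
    ∀ j ≤ n, (expOpD n p rU U UD rS S j).ModeBound (B + n * BU) := by
  intro j hj
  refine TrigPoly.modeBound_flatMap fun i hi' => ?_
  have hin : i ≤ n := Nat.lt_succ_iff.1 (List.mem_range.1 hi')
  by_cases h : i * p ≤ j
  · rw [if_pos h]
    by_cases hi0 : i = 0
    · rw [if_pos hi0]; exact (hS j hj).mono (Nat.le_add_right _ _)
    · rw [if_neg hi0]
      by_cases hij : i * p = j
      · rw [if_pos hij]
        refine ((modeBound_adPow hU (i - 1) hUD).constSMul _).mono ?_
        have : (i - 1) * BU ≤ n * BU := Nat.mul_le_mul_right BU (by omega)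
        omega
      · rw [if_neg hij]
        refine ((modeBound_adPow hU i (hS (j - i * p) (le_trans (Nat.sub_le _ _) hj))).constSMul _).mono ?_
        have : i * BU ≤ n * BU := Nat.mul_le_mul_right BU hin
        omega
  · rw [if_neg h]; exact TrigPoly.modeBound_nil _

/-- Generic `e^{ε^p ad U}`: all components bounded by `B + n B_U`. [folklore] -/
theorem modeBound_expOp {p rU : ℕ} {U : TrigPoly m} {BU : ℕ} (hU : U.ModeBound BU)
    {rS : ℕ} {S : SymSeries m} {B : ℕ} (hS : ∀ j ≤ n, (S j).ModeBound B) :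
    ∀ j ≤ n, (expOp n p rU U rS S j).ModeBound (B + n * BU) := by
  intro j hj
  refine TrigPoly.modeBound_flatMap fun i hi' => ?_
  have hin : i ≤ n := Nat.lt_succ_iff.1 (List.mem_range.1 hi')
  by_cases h : i * p ≤ j
  · rw [if_pos h]
    by_cases hi0 : i = 0
    · rw [if_pos hi0]; exact (hS j hj).mono (Nat.le_add_right _ _)
    · rw [if_neg hi0]
      refine ((modeBound_adPow hU i (hS (j - i * p) (le_trans (Nat.sub_le _ _) hj))).constSMul _).mono ?_
      have : i * BU ≤ n * BU := Nat.mul_le_mul_right BU hin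
      omega
  · rw [if_neg h]; exact TrigPoly.modeBound_nil _

/-- Mode bounds after replacing a component. [folklore] -/
theorem modeBound_update {S : SymSeries m} {B : ℕ} (hS : ∀ j ≤ n, (S j).ModeBound B) (k : ℕ) {P : TrigPoly m}
    (hP : P.ModeBound B) : ∀ j ≤ n, (Function.update S k P j).ModeBound B := by
  intro j hj
  by_cases hjk : j = k
  · subst hjk; rw [Function.update_self]; exact hP
  · rw [Function.update_of_ne hjk]; exact hS j hj

end SymSeries

/-! ### Resonant terms (images of `𝓡`) -/

namespace TrigTerm

/-- A term is RESONANT at scale `δ`: its coefficients vanish wherever `|k·ω| ≥ 2δ` (as the images of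
`𝓡` with a profile vanishing outside `(-2, 2)`). [cite: DeRoeckHuveneers2015, §3.1 (`𝓡`) and §5.4 (5.12)] -/
def ResonantOnly (t : TrigTerm m) (δ : ℝ) : Prop :=
  ∀ w : Fin m → ℝ, 2 * δ ≤ |modeFreq t.mode w| → t.cosCoeff δ w = 0 ∧ t.sinCoeff δ w = 0

/-- Images of `𝓡` are resonant (`δ > 0`, profile zero outside `(-2, 2)`). [cite: DeRoeckHuveneers2015, §3.1] -/
theorem resonantOnly_resCut {ρ : ℝ → ℝ} (hρ : ∀ s, 2 ≤ |s| → ρ s = 0) {δ : ℝ} (hδ : 0 < δ) (t : TrigTerm m) :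
    (t.resCut ρ).ResonantOnly δ := by
  intro w hw
  rw [TrigTerm.mode_resCut] at hw
  have h : ρ (modeFreq t.mode w / δ) = 0 := by
    apply hρ
    rw [abs_div, abs_of_pos hδ, le_div_iff₀ hδ]
    linarith
  simp [TrigTerm.resCut, TrigTerm.smulFun, h]

/-- Functional multiples of resonant terms are resonant. [folklore] -/
theorem ResonantOnly.smulFun {t : TrigTerm m} {δ : ℝ} (h : t.ResonantOnly δ) (θ : ℝ → (Fin m → ℝ) → ℝ) :
    (t.smulFun θ).ResonantOnly δ := fun w hw => by
  simp [TrigTerm.smulFun, (h w hw).1, (h w hw).2]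

end TrigTerm

namespace TrigPoly

/-- All terms resonant at scale `δ`. [cite: DeRoeckHuveneers2015, §3.2 (3.10)] -/
def ResonantOnly (F : TrigPoly m) (δ : ℝ) : Prop := ∀ t ∈ F, t.ResonantOnly δ

/-- `𝓡 F` is resonant. [cite: DeRoeckHuveneers2015, §3.1] -/
theorem resonantOnly_resCut {ρ : ℝ → ℝ} (hρ : ∀ s, 2 ≤ |s| → ρ s = 0) {δ : ℝ} (hδ : 0 < δ) (F : TrigPoly m) :
    (TrigPoly.resCut ρ F).ResonantOnly δ := fun s hs => by
  obtain ⟨t, _, rfl⟩ := List.mem_map.1 hs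
  exact TrigTerm.resonantOnly_resCut hρ hδ t

/-- Functional multiples. [folklore] -/
theorem ResonantOnly.smulFun {F : TrigPoly m} {δ : ℝ} (h : F.ResonantOnly δ) (θ : ℝ → (Fin m → ℝ) → ℝ) :
    (TrigPoly.smulFun θ F).ResonantOnly δ := fun s hs => by
  obtain ⟨t, ht, rfl⟩ := List.mem_map.1 hs
  exact (h t ht).smulFun θ

/-- Sublists (filters) of resonant polynomials are resonant. [folklore] -/
theorem ResonantOnly.filter {F : TrigPoly m} {δ : ℝ} (h : F.ResonantOnly δ) (p : TrigTerm m → Bool) :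
    ResonantOnly (F.filter p) δ := fun t ht => h t (List.mem_of_mem_filter ht)

end TrigPoly

end Literature.MathematicalPhysics.KineticTheory.HeatConduction

end
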